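import Summits.NavierStokesRegularity.NavierStokesRegularity.Theorems.PerpetualPumpCircuitPumpPrecursorTower
import Literature.Analysis.ODE.OneSidedComparison

/-!
# Signed precursor carriers of a truncated Toda solution
# (crux `PerpetualPump.CircuitPump`, stmt-NavierStokesRegularity-1834;
# line `singular-clock-gspt`, sub-goal `toda_precursor_signed` of `stub_clockBox`)

Under the hypotheses of `toda_precursor_tower` (the `L`-truncated seeded graded Toda lattice on
`[0, T]`, `1 < lam ≤ 2`, `0 ≤ ε ≤ 1`, precursors `n ≥ 2` starting in the box
`|a n| ≤ α (2 lam)^{-n}`, `0 ≤ b n ≤ β (2 lam)^{-n}`), the precursor carriers obey the ONE-SIDED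
bound `-|a n 0| - 28 β² (2 lam)^{-n} t ≤ a n t` (`toda_precursor_signed`): in
`ȧ_n = -(lam^{4n/5} + ε lamⁿ b_n) a_n - lamⁿ b_n² + lam^{n-1} b_{n-1}²` the influx is nonnegative
and the bracket is a damping (`b_n ≥ 0`), so wherever `a_n ≤ 0` one has `ȧ_n ≥ -lamⁿ b_n²`, while
the outflux is `≤ β² (2 lam)^{-n} / 4` by the bond bound `b_n ≤ β (2 lam)^{-n}` of
`toda_precursor_tower`; a strict lower fence with margin `δ → 0`
(Mathlib `image_le_of_deriv_right_lt_deriv_boundary'`) concludes. [folklore]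
-/

noncomputable section

-- the summit namespace `…NavierStokesRegularity.NavierStokesRegularity…` is the tree convention
set_option linter.dupNamespace false

namespace Summit.NavierStokesRegularity.NavierStokesRegularity.Theorems.PerpetualPumpCircuitPump

open Set
open Literature.Analysis.ODE

/-- One-sided flux fence: if `h' ≤ K` wherever `h ≥ 0` on `[0, τ)` (`h` continuous on `[0, τ]`
with right derivative `h'`, `0 ≤ K`, `h 0 ≤ A₀`, `0 ≤ A₀`), then `h t ≤ A₀ + K t` on `[0, τ]`
(strict fence with margin `δ`, then `δ → 0`). [folklore] -/
theorem le_add_mul_of_deriv_right_le_of_nonneg {h h' : ℝ → ℝ} {τ K A₀ : ℝ}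
    (hh : ContinuousOn h (Icc 0 τ)) (hh' : ∀ x ∈ Ico 0 τ, HasDerivWithinAt h (h' x) (Ici x) x)
    (hK : 0 ≤ K) (hA : 0 ≤ A₀) (h0 : h 0 ≤ A₀)
    (hb : ∀ x ∈ Ico 0 τ, 0 ≤ h x → h' x ≤ K) : ∀ t ∈ Icc 0 τ, h t ≤ A₀ + K * t := by
  intro t ht
  have key : ∀ δ : ℝ, 0 < δ → h t ≤ A₀ + δ + (K + δ) * t := by
    intro δ hδ
    have hB : ∀ x ∈ Ico (0 : ℝ) τ,
        HasDerivWithinAt (fun y => A₀ + δ + (K + δ) * y) (K + δ) (Ici x) x := by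
      intro x _
      simpa using (((hasDerivAt_id x).const_mul (K + δ)).const_add (A₀ + δ)).hasDerivWithinAt
    have hBc : ContinuousOn (fun y => A₀ + δ + (K + δ) * y) (Icc 0 τ) :=
      (continuous_const.add (continuous_const.mul continuous_id)).continuousOn
    refine image_le_of_deriv_right_lt_deriv_boundary' hh hh'
      (by simp only [mul_zero, add_zero]; linarith) hBc hB (fun x hx hx' => ?_) ht
    have hx0 : 0 ≤ h x := by rw [hx']; have := hx.1; positivity
    linarith [hb x hx hx0]
  refine le_of_forall_pos_le_add fun e he => ?_
  have h1t : 0 < 1 + t := by linarith [ht.1]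
  have hδ : 0 < e / (1 + t) := div_pos he h1t
  have h3 : e / (1 + t) + e / (1 + t) * t = e := by field_simp
  linarith [key _ hδ]

/-- **SIGNED PRECURSOR CARRIERS.** Under the hypotheses of `toda_precursor_tower`, the precursor
carriers obey the ONE-SIDED bound that drops the (nonnegative) influx `lam^{n−1} b_{n−1}²`: the
bracket `-(lam^{4n/5} + ε lamⁿ bₙ) aₙ` is a damping (`bₙ ≥ 0`), so only the outflux
`lamⁿ bₙ² ≤ β² (2lam)^{−n}/4` pushes `aₙ` down. (Needed for the lower face of the precursor boxes
under INTO, where the influx from the active new bond is large.) [folklore] -/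
theorem toda_precursor_signed :
    ∀ (lam ε T α β Zb M : ℝ) (L : ℕ) (a b : ℤ → ℝ → ℝ),
    1 < lam → lam ≤ 2 → 0 ≤ ε → ε ≤ 1 → 0 < T → T ≤ 1 / 2 → 0 ≤ α → 0 ≤ β → β ≤ 1 → 0 ≤ Zb →
    M = α + 4 * lam ^ 3 * Zb ^ 2 * T → 0 < M → M ≤ 2 / 5 → 18 * ε * M ^ 2 ≤ β → 28 * β ^ 2 * T ≤ M →
    (∀ n : ℤ, (L : ℤ) < |n| → ∀ t ∈ Set.Icc 0 T, a n t = 0 ∧ b n t = 0) →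
    (∀ n : ℤ, |n| ≤ (L : ℤ) → ContinuousOn (a n) (Set.Icc 0 T) ∧ ContinuousOn (b n) (Set.Icc 0 T)) →
    (∀ n : ℤ, |n| ≤ (L : ℤ) → ∀ t ∈ Set.Ico 0 T,
      HasDerivWithinAt (a n)
        (-(lam ^ ((4 / 5 : ℝ) * n)) * a n t - lam ^ (n : ℝ) * b n t ^ 2 +
          lam ^ ((n : ℝ) - 1) * b (n - 1) t ^ 2 - ε * lam ^ (n : ℝ) * a n t * b n t) (Set.Ici t) t ∧
      HasDerivWithinAt (b n)
        (-(lam ^ ((4 / 5 : ℝ) * n)) * b n t + lam ^ (n : ℝ) * b n t * (a n t - a (n + 1) t) +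
          ε * lam ^ (n : ℝ) * a n t ^ 2) (Set.Ici t) t) →
    (∀ n : ℤ, 0 ≤ b n 0) →
    (∀ t ∈ Set.Icc 0 T, b 1 t ≤ Zb) →
    (∀ n : ℤ, 2 ≤ n → |a n 0| ≤ α * (2 * lam) ^ (-(n : ℝ)) ∧ b n 0 ≤ β * (2 * lam) ^ (-(n : ℝ))) →
    ∀ t ∈ Set.Icc 0 T, ∀ n : ℤ, 2 ≤ n →
      -|a n 0| - 28 * β ^ 2 * (2 * lam) ^ (-(n : ℝ)) * t ≤ a n t := by
  intro lam ε T α β Zb M L a b h1 h2 hε0 hε1 hT hT2 hα hβ hβ1 hZb hM hM0 hM25 hεM hβT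
    hzero hcont hode hb0 hZ hinit t ht n hn
  -- the landed tower: bond positivity and the bond bound `max (initial, seed floor)`
  have htw := toda_precursor_tower lam ε T α β Zb M L a b h1 h2 hε0 hε1 hT hT2 hα hβ hβ1 hZb hM
    hM0 hM25 hεM hβT hzero hcont hode hb0 hZ hinit
  obtain ⟨F3, -, -, F5, F6, -⟩ := precursor_rpow_facts (x := (n : ℝ)) h1 (by exact_mod_cast hn)
  have hr0 : 0 < (2 * lam) ^ (-(n : ℝ)) := by positivity
  have hp0 : 0 < lam ^ (n : ℝ) := by positivity
  have hd0 : 0 < lam ^ ((4 / 5 : ℝ) * (n : ℝ)) := by positivity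
  set r := (2 * lam) ^ (-(n : ℝ))
  set p := lam ^ (n : ℝ)
  set d := lam ^ ((4 / 5 : ℝ) * (n : ℝ))
  have hC0 : 0 ≤ 28 * β ^ 2 * r := by positivity
  have habs : |n| = n := abs_of_nonneg (by omega)
  rcases le_or_gt n (L : ℤ) with hnL | hnL
  swap
  · -- modes beyond the truncation vanish identically
    have hnL' : (L : ℤ) < |n| := by rw [habs]; exact hnL
    rw [(hzero n hnL' t ht).1]
    have : 0 ≤ 28 * β ^ 2 * r * t := mul_nonneg hC0 ht.1
    linarith [abs_nonneg (a n 0)]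
  have hnL' : |n| ≤ (L : ℤ) := by rw [habs]; exact hnL
  -- the precursor bond at scale `n` is nonnegative and below `β r` on `[0, T]`
  have hbβ : ∀ s ∈ Icc 0 T, 0 ≤ b n s ∧ b n s ≤ β * r := by
    intro s hs
    obtain ⟨hbs0, hbmax, -, -⟩ := htw s hs n hn
    refine ⟨hbs0, ?_⟩
    rw [F5] at hbmax
    refine hbmax.trans (max_le (hinit n hn).2 ?_)
    have hm : 18 * ε * M ^ 2 * (lam ^ ((n : ℝ) / 5) * r) ≤ β * 1 :=
      mul_le_mul hεM F6 (by positivity) hβ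
    calc 18 * ε * M ^ 2 * lam ^ ((n : ℝ) / 5) * (r * r)
        = 18 * ε * M ^ 2 * (lam ^ ((n : ℝ) / 5) * r) * r := by ring
      _ ≤ β * 1 * r := mul_le_mul_of_nonneg_right hm hr0.le
      _ = β * r := by ring
  -- wherever `a n ≤ 0` the carrier is pushed down only by the outflux `p bₙ² ≤ β² r / 4 ≤ 28 β² r`
  have hfence : ∀ s ∈ Ico 0 T, 0 ≤ -a n s →
      -(-d * a n s - p * b n s ^ 2 + lam ^ ((n : ℝ) - 1) * b (n - 1) s ^ 2 -
        ε * p * a n s * b n s) ≤ 28 * β ^ 2 * r := by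
    intro s hs hs0
    obtain ⟨hbs0, hbs⟩ := hbβ s (Ico_subset_Icc_self hs)
    have hy : p * b n s ^ 2 ≤ β ^ 2 * r / 4 := by
      have hsq : b n s ^ 2 ≤ (β * r) ^ 2 := pow_le_pow_left₀ hbs0 hbs 2
      have := mul_le_mul_of_nonneg_left hsq hp0.le
      have := mul_le_mul_of_nonneg_left F3 (by positivity : (0 : ℝ) ≤ β ^ 2 * r)
      linarith
    have hin : 0 ≤ lam ^ ((n : ℝ) - 1) * b (n - 1) s ^ 2 := by positivity
    have c1 : 0 ≤ d * -a n s := mul_nonneg hd0.le hs0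
    have c2 : 0 ≤ ε * p * b n s * -a n s := mul_nonneg (by positivity) hs0
    have hβr : 0 ≤ β ^ 2 * r := by positivity
    linarith
  have key : -a n t ≤ |a n 0| + 28 * β ^ 2 * r * t :=
    le_add_mul_of_deriv_right_le_of_nonneg (τ := T) (K := 28 * β ^ 2 * r) (A₀ := |a n 0|)
      (h := fun s => -a n s)
      (h' := fun s => -(-d * a n s - p * b n s ^ 2 + lam ^ ((n : ℝ) - 1) * b (n - 1) s ^ 2 -
        ε * p * a n s * b n s))
      (hcont n hnL').1.neg (fun s hs => (hode n hnL' s hs).1.neg) hC0 (abs_nonneg _)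
      (neg_le_abs _) hfence t ht
  linarith
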